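import Summits.HodgeConjecture.HodgeCM.Model.PadH0_2

/-! PORT of `HodgeCM/Model/PadH0.lean` (HodgeCMPerL run 82) — part 3: continuation of `Summits.HodgeConjecture.HodgeCM.Model.PadH0_2` (split at a top-level declaration boundary by port_pkg.py; scope re-opened below; declarations unchanged). -/

-- port_pkg: scope re-opened for this part (file-level context, then the namespace/section stack open at the cut)
noncomputable section
open scoped TensorProduct
namespace HodgeCM
open Literature.AlgebraicGeometry.Motives (CMType HodgeStructure)
open Literature.AlgebraicGeometry.Motives.HodgeStructure (EndAction ofRat conj complexConj prodEquiv pureFiltration)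
namespace Universe
variable (U : Universe)
namespace PadH0
variable {U} (D : U.PadDatum)
variable {D}
section Weights
variable {F : CMField} {n : ℕ} (Θ : Fin (n + 1) → CMType F)
set_option smartUnfolding false in
/-- Conversely, a weight vector of `U` is one of `U♭` (in the geometric summand). -/
theorem isWeightVector_ofUC {S : Fin (n + 1) → Finset ((F : Type) →+* ℂ)} {k : ℕ} {x : U.CohC (U.cmProd F Θ) k}
    (hx : U.IsWeightVector F Θ S k x) : (U.padH0 D).IsWeightVector F Θ S k (ofUC D (U.cmProd F Θ) k x) := by
  intro j a M hM
  have h := congrArg (ofUC D (U.cmProd F Θ) k) (hx j a M ((isFactorAct_iff (U := U) (D := D) Θ j a M).mp hM))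
  rw [map_smul] at h
  exact (pullC_ofUC (D := D) M k x).trans h

end Weights

/-! ## 4. `U♭` is a model whenever `U` is -/

set_option smartUnfolding false in
/-- **`U♭` satisfies all 28 model facts whenever `U` does** — given the laws of the pad datum and `dim (X × Y) = dim X + dim Y`
in `U` (`Fact_dimProd`, used for M28 only: with M11 it gives `dim P = 4g ≥ 4`, so the source degree `2(dim P - 2) = 8g - 4`
of the algebraic self-duality is never the padded degree `0`).  Facts living in positive literal degrees (or not mentioning
cohomology) hold in `U♭` by the proof term for `U`. -/
theorem modelAxioms (M : U.ModelAxioms) (hd : U.Fact_dimProd) (hD : D.Laws) : (U.padH0 D).ModelAxioms where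
  pull_id X k := by
    show PadZero.map k (U.pull (U.idMor X) k) (D.map (U.idMor X)) = LinearMap.id
    rw [M.pull_id X k, hD.map_id X]
    exact PadZero.map_id k
  pull_comp X Y Z f g k := by
    show PadZero.map k (U.pull (U.comp f g) k) (D.map (U.comp f g)) =
      PadZero.map k (U.pull f k) (D.map f) ∘ₗ PadZero.map k (U.pull g k) (D.map g)
    rw [M.pull_comp X Y Z f g k, hD.map_comp X Y Z f g]
    exact PadZero.map_comp k _ _ _ _
  pull_cup X Y f i j x y := by
    refine (ext_iff (D := D) X (i + j) _ _).mpr ⟨?_, ?_⟩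
    · rw [toU_pull, toU_cup, toU_cup, toU_pull, toU_pull]
      exact M.pull_cup X Y f i j _ _
    · rw [padOf_pull, padOf_cup, padOf_cup, map_zero]
  pull_hodge X Y f k p := by
    rintro _ ⟨y, hy, rfl⟩
    rw [SetLike.mem_coe, mem_F_iff] at hy
    rw [mem_F_iff, toUC_pullC, padOfC_pullC]
    exact ⟨M.pull_hodge X Y f k p ⟨_, hy.1, rfl⟩, hD.map_hodge X Y f p ⟨_, hy.2, rfl⟩⟩
  cup2_hodge X k p q x y hx hy := by
    rw [cup2C_eq_cupC, mem_F_iff, toUC_cupC, padOfC_cupC, ← cup2C_eq_cupC]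
    exact ⟨M.cup2_hodge X k p q _ _ ((mem_F_iff (D := D) X k p x).mp hx).1 ((mem_F_iff (D := D) X k q y).mp hy).1,
      Submodule.zero_mem _⟩
  tr_degree X k hk := by
    show U.tr X k ∘ₗ PadZero.fst (U.Coh X k) (D.P X) k = 0
    rw [M.tr_degree X k hk, LinearMap.zero_comp]
  alg_le_hodge X p := by
    intro x hx
    rw [mem_alg_iff] at hx
    show x ∈ ((U.padH0 D).hodge X (2 * p)).hodgeClasses (p : ℤ)
    rw [HodgeStructure.mem_hodgeClasses_iff, ofRat_mem_F_iff, hx.2, map_zero]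
    exact ⟨M.alg_le_hodge X p hx.1, Submodule.zero_mem _⟩
  pull_alg X Y f p := by
    rintro _ ⟨y, hy, rfl⟩
    rw [SetLike.mem_coe, mem_alg_iff] at hy
    rw [mem_alg_iff, toU_pull, padOf_pull, hy.2, map_zero]
    exact ⟨M.pull_alg X Y f p ⟨_, hy.1, rfl⟩, rfl⟩
  cup_alg X x y hx hy := M.cup_alg X x y hx hy
  lefschetz11 X := M.lefschetz11 X
  cmAV := M.cmAV
  eigenLine := M.eigenLine
  alphaLine := M.alphaLine
  cmDominated X hX := by
    obtain ⟨F, hG, h6, n, Θ, s, π, N, hN, h, hP⟩ := hD.dominated X hX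
    refine ⟨F, hG, h6, n, Θ, s, π, N, hN, fun k => LinearMap.ext fun x => (ext_iff (D := D) X k _ _).mpr ⟨?_, ?_⟩⟩
    · rw [toU_pull]
      refine (LinearMap.congr_fun (h k) (toU D X k x)).trans ?_
      rw [LinearMap.smul_apply, LinearMap.id_apply, LinearMap.smul_apply, LinearMap.id_apply, map_smul]
    · by_cases hk : k = 0
      · subst hk
        rw [padOf_pull, pow_zero, one_smul, LinearMap.id_apply]
        exact LinearMap.congr_fun hP _
      · rw [padOf_of_ne (D := D) X hk, padOf_of_ne (D := D) X hk]
  weilLine_rank := M.weilLine_rank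
  weilLine_hodge := M.weilLine_hodge
  pms_dim := M.pms_dim
  lift := M.lift
  cup_comm1 := M.cup_comm1
  cup_interchange := M.cup_interchange
  kunneth1 := M.kunneth1
  H1_rank := M.H1_rank
  H4_span := M.H4_span
  cmEnd := M.cmEnd
  conjIsogeny := M.conjIsogeny
  gysin_surface S X f hS := by
    obtain ⟨c, hc, h⟩ := M.gysin_surface S X f hS
    refine ⟨ofU D X (2 * (U.dim X - 2)) c, ofU_mem_alg (D := D) X _ hc, fun y => ?_⟩
    rw [tr_apply, toU_pull, tr_apply, toU_cup, toU_ofU]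
    exact h (toU D X 4 y)
  deg_diag K Φ a Ma hMa k := by
    have h := M.deg_diag K Φ a Ma (isDiagAct_toU hMa) k
    ext x
    rw [LinearMap.comp_apply, LinearMap.smul_apply, tr_apply, toU_pull, tr_apply]
    exact LinearMap.congr_fun h (toU D (U.prod4 K Φ) k x)
  algDuality K Φ := by
    obtain ⟨E, hE1, hE2, hE3⟩ := M.algDuality K Φ
    have hP := dim_prod4 M hd K Φ
    have hg := one_le_halfDegree' K
    have hdim : 2 * (U.dim (U.prod4 K Φ) - 2) ≠ 0 := by omega
    refine ⟨ofU D _ 4 ∘ₗ E ∘ₗ toU D _ (2 * (U.dim (U.prod4 K Φ) - 2)), ?_, ?_, ?_⟩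
    · exact (ofU_bijective_of_ne (D := D) _ (by norm_num)).comp (hE1.comp (toU_bijective_of_ne (D := D) _ hdim))
    · rintro _ ⟨x, hx, rfl⟩
      rw [SetLike.mem_coe, mem_alg_iff] at hx
      exact ofU_mem_alg (D := D) _ 2 (hE2 ⟨_, hx.1, rfl⟩)
    · intro a Ma Mb hMa hMb
      have h := hE3 a Ma Mb (isDiagAct_toU hMa) (isDiagAct_toU hMb)
      ext x
      have hx := LinearMap.congr_fun h (toU D (U.prod4 K Φ) (2 * (U.dim (U.prod4 K Φ) - 2)) x)
      simp only [LinearMap.comp_apply, LinearMap.smul_apply] at hx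
      rw [LinearMap.comp_apply, LinearMap.comp_apply, LinearMap.comp_apply, LinearMap.comp_apply,
        LinearMap.smul_apply, LinearMap.comp_apply, LinearMap.comp_apply, toU_pull, pull_ofU, hx, map_smul]

/-! ## 5. Transfer of N1, N2, F4, F5, `Fact_dimProd`, `W_RK4`, the realisation inputs; criteria for N3, N4, `HC_CM`,
`PohlmannSpan` -/

set_option smartUnfolding false in
/-- N1 `Fact_cupExterior` is the same statement for `U♭` and `U` (degrees `≥ 1` are not padded). -/
theorem fact_cupExterior_iff : (U.padH0 D).Fact_cupExterior ↔ U.Fact_cupExterior :=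
  ⟨fun h F n Θ k => (cupExterior_iff (D := D) (U.cmProd F Θ) k).mp (h F n Θ k),
    fun h F n Θ k => (cupExterior_iff (D := D) (U.cmProd F Θ) k).mpr (h F n Θ k)⟩

/-- N2 `Fact_cup_hodge` transfers (the pad component of a cup product is `0`). -/
theorem fact_cup_hodge (h : U.Fact_cup_hodge) : (U.padH0 D).Fact_cup_hodge := by
  intro X i j p q x y hx hy
  rw [mem_F_iff, toUC_cupC, padOfC_cupC]
  exact ⟨h X i j p q _ _ ((mem_F_iff (D := D) X i p x).mp hx).1 ((mem_F_iff (D := D) X j q y).mp hy).1,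
    Submodule.zero_mem _⟩

/-- N3 `Fact_pull_H0` holds in `U♭` iff it holds in `U` AND every endomorphism acts trivially on the pad. -/
theorem fact_pull_H0_iff :
    (U.padH0 D).Fact_pull_H0 ↔ U.Fact_pull_H0 ∧ ∀ (X : U.Var) (f : U.Mor X X), D.map f = LinearMap.id := by
  constructor
  · intro h
    refine ⟨fun X f => ?_, fun X f => ?_⟩
    · ext x
      have hx := congrArg (toU D X 0) (LinearMap.congr_fun (h X f) (ofU D X 0 x))
      rwa [toU_pull, toU_ofU, LinearMap.id_apply, toU_ofU] at hx
    · ext v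
      have hv := congrArg (padOf D X 0) (LinearMap.congr_fun (h X f) (ofPad D X 0 v))
      rwa [padOf_pull, padOf_ofPad_zero, LinearMap.id_apply, padOf_ofPad_zero] at hv
  · rintro ⟨h, hP⟩ X f
    show PadZero.map 0 (U.pull f 0) (D.map f) = LinearMap.id
    rw [h X f, hP X f]
    exact PadZero.map_id 0

/-- N4 `Fact_hodge_F0` holds in `U♭` iff it holds in `U` AND every pad structure has `F⁰ = ⊤`. -/
theorem fact_hodge_F0_iff : (U.padH0 D).Fact_hodge_F0 ↔ U.Fact_hodge_F0 ∧ ∀ X : U.Var, (D.hs X).F 0 = ⊤ := by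
  constructor
  · intro h
    refine ⟨fun X k => ?_, fun X => ?_⟩
    · refine eq_top_iff.mpr fun x _ => ?_
      have hx : ofUC D X k x ∈ ((U.padH0 D).hodge X k).F 0 := by rw [h X k]; exact Submodule.mem_top
      rw [mem_F_iff, toUC_ofUC] at hx
      exact hx.1
    · refine eq_top_iff.mpr fun v _ => ?_
      have hv : ofPadC D X 0 v ∈ ((U.padH0 D).hodge X 0).F 0 := by rw [h X 0]; exact Submodule.mem_top
      rw [mem_F_iff, padOfC_ofPadC_zero] at hv
      exact hv.2
  · rintro ⟨h, hP⟩ X k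
    refine eq_top_iff.mpr fun x _ => ?_
    rw [mem_F_iff, h X k, hP X]
    exact ⟨Submodule.mem_top, Submodule.mem_top⟩

/-- F4 `Fact_cupAlg` transfers. -/
theorem fact_cupAlg (h : U.Fact_cupAlg) : (U.padH0 D).Fact_cupAlg := by
  intro X p q x y hx hy
  rw [mem_alg_iff, toU_castCoh, toU_cup, padOf_castCoh, padOf_cup]
  exact ⟨h X p q _ _ ((mem_alg_iff (D := D) X p x).mp hx).1 ((mem_alg_iff (D := D) X q y).mp hy).1, rfl⟩

/-- F5 `Fact_cupAssoc` transfers. -/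
theorem fact_cupAssoc (h : U.Fact_cupAssoc) : (U.padH0 D).Fact_cupAssoc := by
  intro X i j k a b c
  refine (ext_iff (D := D) X _ _ _).mpr ⟨?_, ?_⟩
  · rw [toU_cup, toU_cup, toU_castCoh, toU_cup, toU_cup]
    exact h X i j k _ _ _
  · rw [padOf_cup, padOf_castCoh, padOf_cup]

/-- `Fact_dimProd` is a statement about `dim` and `prod` only. -/
theorem fact_dimProd_iff : (U.padH0 D).Fact_dimProd ↔ U.Fact_dimProd := Iff.rfl

/-- `W_RK4` (degrees `1, 2, 4` only) is literally the same statement for `U♭` and `U`. -/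
theorem w_RK4_iff : (U.padH0 D).W_RK4 ↔ U.W_RK4 := Iff.rfl

/-- `RealisationExistsFace` (theta one-forms: degrees `1` and `4`) transfers verbatim. -/
theorem realisationExistsFace (h : U.RealisationExistsFace) : (U.padH0 D).RealisationExistsFace := by
  intro F hG h6 f ι₁ hf V
  obtain ⟨r⟩ := h F hG h6 f ι₁ hf V
  exact ⟨{ r with }⟩

/-- `RealisationExistsPerL` transfers verbatim. -/
theorem realisationExistsPerL (h : U.RealisationExistsPerL) : (U.padH0 D).RealisationExistsPerL := by
  intro K L j hN hK hL φ hφ ι₁ hι t ht V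
  obtain ⟨r⟩ := h K L j hN hK hL φ hφ ι₁ hι t ht V
  exact ⟨{ r with }⟩

/-- **Rational Hodge classes of `U♭` when the pad carries none**: if the pad structures have no nonzero rational class of
filtration level `0`, the Hodge classes of `U♭` are exactly the Hodge classes of `U` in the geometric summand. -/
theorem mem_hodgeClassesOf_iff_of_padHodge (hP : ∀ X : U.Var, (D.hs X).hodgeClasses 0 = ⊥) (X : U.Var) (p : ℕ)
    (x : (U.padH0 D).Coh X (2 * p)) :
    x ∈ (U.padH0 D).hodgeClassesOf X p ↔ toU D X (2 * p) x ∈ U.hodgeClassesOf X p ∧ padOf D X (2 * p) x = 0 := by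
  rw [mem_hodgeClassesOf_iff]
  refine and_congr Iff.rfl ?_
  rcases Nat.eq_zero_or_pos p with rfl | hp
  · show padOf D X (2 * 0) x ∈ (D.hs X).hodgeClasses 0 ↔ _
    rw [hP X, Submodule.mem_bot]
  · have h0 : padOf D X (2 * p) x = 0 := padOf_of_ne (D := D) X (by omega) x
    rw [h0]
    exact ⟨fun _ => rfl, fun _ => Submodule.zero_mem _⟩

/-- **COR-CM transfers when the pad carries no rational Hodge class.** -/
theorem hc_cm_of_padHodge (hP : ∀ X : U.Var, (D.hs X).hodgeClasses 0 = ⊥) (h : U.HC_CM) : (U.padH0 D).HC_CM := by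
  intro X hX p x hx
  rw [mem_hodgeClassesOf_iff_of_padHodge hP] at hx
  exact (mem_alg_iff (D := D) X p x).mpr ⟨h X hX p hx.1, hx.2⟩

/-- … and conversely COR-CM for `U♭` gives COR-CM for `U` (always). -/
theorem hc_cm_toU (h : (U.padH0 D).HC_CM) : U.HC_CM := by
  intro X hX p x hx
  have hx' : ofU D X (2 * p) x ∈ (U.padH0 D).hodgeClassesOf X p := by
    rw [mem_hodgeClassesOf_iff, toU_ofU, padOf_ofU]
    exact ⟨hx, Submodule.zero_mem _⟩
  have h' := (mem_alg_iff (D := D) X p _).mp (h X hX p hx')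
  rw [toU_ofU] at h'
  exact h'.1

set_option smartUnfolding false in
/-- **Pohlmann's span inclusion transfers when the pad carries no rational Hodge class**: then a rational Hodge class of
`H♭^{2p}(A′)` is `(c, 0)` with `c` a rational Hodge class of `H^{2p}(A′)`, and weight vectors of `U` are weight vectors of
`U♭` in the geometric summand. -/
theorem pohlmannSpan_of_padHodge (hP : ∀ X : U.Var, (D.hs X).hodgeClasses 0 = ⊥) (h : U.PohlmannSpan) :
    (U.padH0 D).PohlmannSpan := by
  intro F hG h6 n Θ p
  rintro _ ⟨x, hx, rfl⟩
  rw [SetLike.mem_coe, mem_hodgeClassesOf_iff_of_padHodge hP] at hx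
  have hxU := h F hG h6 n Θ p ⟨toU D ((U.padH0 D).cmProd F Θ) (2 * p) x, hx.1, rfl⟩
  rw [Submodule.restrictScalars_mem] at hxU ⊢
  -- `x = ofU (toU x)` as its pad component vanishes, so `ofRat x = ofUC (ofRat (toU x))`
  have hx1 : ofU D ((U.padH0 D).cmProd F Θ) (2 * p) (toU D ((U.padH0 D).cmProd F Θ) (2 * p) x) = x := by
    have h1 := ofU_toU_add (D := D) ((U.padH0 D).cmProd F Θ) (2 * p) x
    rwa [hx.2, map_zero, add_zero] at h1
  have hx0 : (ofRat x : (U.padH0 D).CohC ((U.padH0 D).cmProd F Θ) (2 * p)) =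
      ofUC D ((U.padH0 D).cmProd F Θ) (2 * p) (ofRat (toU D ((U.padH0 D).cmProd F Θ) (2 * p) x)) := by
    rw [ofUC_ofRat, hx1]
  rw [hx0]
  -- weight vectors of `U` are weight vectors of `U♭` in the geometric summand
  have hsub : (ofUC D ((U.padH0 D).cmProd F Θ) (2 * p)) ''
      {y | ∃ S : Fin (n + 1) → Finset ((F : Type) →+* ℂ), IsHodgeWeight Θ p S ∧ U.IsWeightVector F Θ S (2 * p) y} ⊆
      {y | ∃ S : Fin (n + 1) → Finset ((F : Type) →+* ℂ), IsHodgeWeight Θ p S ∧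
        (U.padH0 D).IsWeightVector F Θ S (2 * p) y} := by
    rintro _ ⟨y, ⟨S, hS, hy⟩, rfl⟩
    exact ⟨S, hS, isWeightVector_ofUC Θ hy⟩
  have hmem : ofUC D ((U.padH0 D).cmProd F Θ) (2 * p) (ofRat (toU D ((U.padH0 D).cmProd F Θ) (2 * p) x)) ∈
      Submodule.span ℂ ((ofUC D ((U.padH0 D).cmProd F Θ) (2 * p)) ''
        {y | ∃ S : Fin (n + 1) → Finset ((F : Type) →+* ℂ), IsHodgeWeight Θ p S ∧ U.IsWeightVector F Θ S (2 * p) y}) := by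
    rw [← Submodule.map_span]
    exact Submodule.mem_map_of_mem hxU
  exact Submodule.span_mono hsub hmem

/-- **Every rational pad vector of filtration level `0` is a rational Hodge class of `H♭⁰`.** -/
theorem ofPad_mem_hodgeClassesOf (X : U.Var) {v : D.P X} (hv : v ∈ (D.hs X).hodgeClasses 0) :
    (ofPad D X 0 v : (U.padH0 D).Coh X (2 * 0)) ∈ (U.padH0 D).hodgeClassesOf X 0 := by
  rw [mem_hodgeClassesOf_iff, toU_ofPad, padOf_ofPad_zero]
  exact ⟨Submodule.zero_mem _, hv⟩

/-- … and it is algebraic only if it is `0`. -/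
theorem ofPad_mem_alg_iff (X : U.Var) (v : D.P X) :
    (ofPad D X 0 v : (U.padH0 D).Coh X (2 * 0)) ∈ (U.padH0 D).alg X 0 ↔ v = 0 := by
  rw [mem_alg_iff, toU_ofPad, padOf_ofPad_zero]
  exact ⟨fun h => h.2, fun h => ⟨Submodule.zero_mem _, h⟩⟩

end PadH0

end Universe

end HodgeCM

end
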